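import Literature.Uncategorized.Crux
import Literature.Topology.FourManifolds.LeeRasmussenParityProofs
import HarnessLib

/-!
# `ZseCruxRasmussen` — negative knowledge II: parity normalisation of the `s`-witness

Support lemmas for crux `stmt-SmoothPoincare4-0366` (`Literature.Uncategorized.Crux`, route ZeroSurgeryExotic crux #2),
from the standing disprover's work file `Cruxes/ZseCruxRasmussen/Disproof.lean` §6:

* `hasRasmussenInvariant_even` — every Rasmussen invariant of a knot is even (the tree's diagram-level theorem
  `GaussDiagram.even_rasmussenInvariant_holds`, Rasmussen 2010 Prop. 3.3, lifted to `Knot.HasRasmussenInvariant`);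
* `crux_iff_two_le_abs` — the crux is equivalent to its form with the witness clause `2 ≤ |s|` in place of
  `s ≠ 0`: a search may discard `|s| = 1` and odd values outright.
References: Rasmussen, Invent. Math. 182 (2010), Prop. 3.3 and Thm. 1 [Rasmussen2010].
-/

noncomputable section

set_option linter.dupNamespace false

namespace Summit.SmoothPoincare4.SmoothPoincare4.Theorems.ZseCruxRasmussen.Negative

open scoped Manifold ContDiff
open Literature.Topology.FourManifolds Literature.Uncategorized

/-- Every Rasmussen invariant of a knot is even. [cite: Rasmussen2010, Prop. 3.3] -/
theorem hasRasmussenInvariant_even {K : Knot} {s : ℤ} (h : K.HasRasmussenInvariant s) : Even s := by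
  obtain ⟨K', D, -, hD, rfl⟩ := h
  exact GaussDiagram.even_rasmussenInvariant_holds ⟨K', hD⟩

/-- The crux with the witness clause normalised to `2 ≤ |s|` (equivalent, by parity).
[cite: Rasmussen2010, Prop. 3.3] -/
theorem crux_iff_two_le_abs : Crux ↔
    ∃ (K K' : Knot) (Y : Type) (_ : TopologicalSpace Y) (_ : ChartedSpace (EuclideanSpace ℝ (Fin 3)) Y)
      (s : ℤ), IsIntegralSurgery (𝓡 3) Y K 0 ∧ IsIntegralSurgery (𝓡 3) Y K' 0 ∧ K.IsSmoothlySlice ∧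
        K'.HasRasmussenInvariant s ∧ 2 ≤ |s| := by
  constructor
  · rintro ⟨K, K', Y, _, _, s, hK, hK', hsl, hs, hs0⟩
    refine ⟨K, K', Y, _, _, s, hK, hK', hsl, hs, ?_⟩
    obtain ⟨t, rfl⟩ := hasRasmussenInvariant_even hs
    have ht : t ≠ 0 := by rintro rfl; exact hs0 (by simp)
    rw [← two_mul, abs_mul, abs_two]
    have : 1 ≤ |t| := Int.one_le_abs ht
    linarith
  · rintro ⟨K, K', Y, _, _, s, hK, hK', hsl, hs, hs2⟩
    refine ⟨K, K', Y, _, _, s, hK, hK', hsl, hs, ?_⟩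
    rintro rfl
    simp at hs2

end Summit.SmoothPoincare4.SmoothPoincare4.Theorems.ZseCruxRasmussen.Negative

end
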